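import Summits.Ventures.PercRepro.Night2TwoOneFatFaces

/-!
# PercRepro — the cell `(2, 1)`: the structure of a lossy big covering set, and its loss with at most one fat closure
(night-2, gen 29)

In the cell `(2, 1)` (`|E ∖ G| = 2`, one coloop `K`, `V = G ∖ K` of rank `5`) a big thin member `B` (`|B ∖ K| ≥ 5`)
loses at its covering set `Q = B ∪ {z}` only if `L1 Q > capS Q ≥ 11/18`.  The thin covering preimages of `Q` are faces
`Q ∖ w` at coloops `w` of `Q ∖ K` (at most three: `card_coloops_le_three`), each requesting at most `7/24`; two faces
give `L1 ≤ 7/12 < 11/18`, so a lossy big covering set has EXACTLY three coloops off `K`, every face at a coloop is a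
thin member, and the non-coloops of `Q ∖ K` (at least three points) have rank `2` — they lie on a line.  No hypothesis
on the fat closures is needed for this.  With at most one fat closure at most one face is fat (two fat faces have
distinct closures: the same closure would contain `Q`, of rank `6 > 5`), so `L1 Q ≤ 7/24 + 2 · 7/30 = 91/120` and the
total loss at `Q` is at most `91/120 − 11/18 = 53/360`.

* `req_le_seven_thirtieths_of_not_fat`: a thin member missing `≥ 3` points requests at most `7/30`;
* **`three_thin_faces_of_loss_ne_zero`**: the structure (three thin faces = the faces at the three coloops of `Q ∖ K`;
  the rest of `Q ∖ K` has rank `2` and `≥ 3` points);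
* `clF_ne_of_fat_faces`: two distinct fat faces of a covering set have distinct closures;
* **`L1_le_of_loss_ne_zero_one_fat`**: `L1 Q ≤ 91/120` with at most one fat closure;
* **`faceLoss_sum_le_one_fat`**: the face losses of ANY set sum to at most `53/360` (at most one fat closure).
-/

namespace PercRepro.Shadow

open Finset PerFlat ThmH

variable {α : Type*} [DecidableEq α] {M : Matroid α} [M.Finite] {G : Finset α}

section OneFatFaces

/-- In the cell `d = 2` a thin member missing at least three points requests at most `7/30`. -/
theorem req_le_seven_thirtieths_of_not_fat (hG : G ∈ flatsQ M (5 + 1)) (hd : (gr M \ G).card = 2)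
    {B : Finset α} (hB : B ∈ thinMembers M 5 G) (hm : ¬ (G \ clF M B).card ≤ 2) : req M 5 B ≤ 7 / 30 := by
  rw [req_eq_of_thin hG hB, hd]
  unfold phiQ
  push_cast
  have h3 : (3 : ℚ) ≤ ((G \ clF M B).card : ℚ) := by exact_mod_cast (by omega : 3 ≤ (G \ clF M B).card)
  rw [div_le_div_iff₀ (by linarith) (by norm_num)]
  linarith

open scoped Classical in
/-- **THE STRUCTURE OF A LOSSY BIG COVERING SET** (cell `(2, 1)`, no hypothesis on the fat closures): if the big thin
member `B` loses at `Q = B ∪ {z}`, then `Q ∖ K` has exactly three coloops, the thin covering preimages of `Q` are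
exactly the three faces at those coloops, and the non-coloops of `Q ∖ K` have rank `2` and at least three points. -/
theorem three_thin_faces_of_loss_ne_zero (hG : G ∈ flatsQ M (5 + 1)) (hd : (gr M \ G).card = 2)
    (hk : kColoops M G = 1) (hs : ∀ e ∈ gr M, ∀ f ∈ gr M, e ≠ f → rkN M {e, f} = 2)
    (hl : ∀ e ∈ gr M, M.Indep {e}) {B : Finset α} (hB : B ∈ thinMembers M 5 G)
    (hbig : 5 ≤ (B \ coloops M G).card) {z : α} (hz : z ∈ G \ clF M B) (hl0 : loss M 5 G B z ≠ 0) :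
    (coloops M (insert z B \ coloops M G)).card = 3 ∧
      (coverPreimages M (Uq M (5 + 2) 5) G (insert z B)).filter (fun F => F ∉ lay0 M 5 G) =
        (coloops M (insert z B \ coloops M G)).image (fun w => (insert z B).erase w) ∧
      rkN M ((insert z B \ coloops M G) \ coloops M (insert z B \ coloops M G)) = 2 ∧
      3 ≤ ((insert z B \ coloops M G) \ coloops M (insert z B \ coloops M G)).card := by
  have hd' : (gr M \ G).card ≤ 5 := by omega
  have hGg : G ⊆ gr M := (mem_flatsQ.1 hG).1
  have hB' : B ∈ membersIn M (Uq M (5 + 2) 5) G := (mem_thinMembers.1 hB).1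
  have hBU : B ∈ Uq M (5 + 2) 5 := (mem_membersIn.1 hB').1
  have hBG : B ⊆ G := (subset_clF hBU).trans (mem_membersIn.1 hB').2
  have hKB : coloops M G ⊆ B := coloops_subset_of_mem_thinMembers hG hd' hB
  have hzB : z ∉ B := notMem_of_notMem_clF hBU (Finset.mem_sdiff.1 hz).2
  have hzK : z ∉ coloops M G := fun h => hzB (hKB h)
  set Q := insert z B with hQ
  have hQG : Q ⊆ G := Finset.insert_subset (Finset.mem_sdiff.1 hz).1 hBG
  have hQK5 : rkN M (Q \ coloops M G) = 5 := rkN_insert_sdiff_coloops_eq_five_of_thin hG hd hk hB hz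
  have hQKcard : 6 ≤ (Q \ coloops M G).card := by
    have h1 : Q \ coloops M G = insert z (B \ coloops M G) := by
      rw [hQ, Finset.insert_sdiff_of_notMem _ hzK]
    rw [h1, Finset.card_insert_of_notMem (fun h => hzB (Finset.mem_sdiff.1 h).1)]
    omega
  have hQKg : Q \ coloops M G ⊆ gr M := Finset.sdiff_subset.trans (hQG.trans hGg)
  -- the covering set is saturated
  have hsat : capS M 5 G Q < L1 M 5 G Q := by
    by_contra h
    push Not at h
    apply hl0
    unfold loss fS
    rw [if_pos h]
    ring
  have hcap := capS_ge_eleven_eighteenths_two_one hd hk hQG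
  set Pre := (coverPreimages M (Uq M (5 + 2) 5) G Q).filter (fun F => F ∉ lay0 M 5 G) with hPre
  have hthin : ∀ F ∈ Pre, F ∈ thinMembers M 5 G := by
    intro F hF
    rw [hPre, Finset.mem_filter, mem_coverPreimages] at hF
    exact mem_thinMembers.2 ⟨hF.1.1, hF.2⟩
  have hsub : Pre ⊆ (coloops M (Q \ coloops M G)).image (fun w => Q.erase w) :=
    thin_coverPreimages_subset_image_coloops hG hd' Q
  have hC3 : (coloops M (Q \ coloops M G)).card ≤ 3 := card_coloops_le_three hs hl hQKg hQK5 hQKcard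
  have hPre3 : Pre.card ≤ 3 := (Finset.card_le_card hsub).trans (Finset.card_image_le.trans hC3)
  -- every thin face requests at most `7/24`, so at least three faces are needed
  have hL1 : L1 M 5 G Q ≤ (Pre.card : ℚ) * (7 / 24) := by
    unfold L1
    rw [← hPre]
    calc ∑ F ∈ Pre, req M 5 F ≤ ∑ _F ∈ Pre, (7 / 24 : ℚ) :=
          Finset.sum_le_sum (fun F hF => req_le_of_thin_two_one hG hd (hthin F hF))
      _ = (Pre.card : ℚ) * (7 / 24) := by rw [Finset.sum_const, nsmul_eq_mul]
  have hPre3' : 3 ≤ Pre.card := by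
    by_contra hlt
    push Not at hlt
    have hc : (Pre.card : ℚ) ≤ 2 := by exact_mod_cast (by omega : Pre.card ≤ 2)
    nlinarith
  have hPreEq : Pre.card = 3 := le_antisymm hPre3 hPre3'
  have hC3' : 3 ≤ (coloops M (Q \ coloops M G)).card := by
    have := (Finset.card_le_card hsub).trans Finset.card_image_le
    omega
  have hCEq : (coloops M (Q \ coloops M G)).card = 3 := le_antisymm hC3 hC3'
  have hImgEq : Pre = (coloops M (Q \ coloops M G)).image (fun w => Q.erase w) := by
    apply Finset.eq_of_subset_of_card_le hsub
    exact Finset.card_image_le.trans (by omega)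
  refine ⟨hCEq, hImgEq, ?_, ?_⟩
  · have h := rkN_sdiff_add_card_of_subset_coloops hQKg (Finset.Subset.refl (coloops M (Q \ coloops M G)))
    rw [hQK5, hCEq] at h
    omega
  · have hCsub : coloops M (Q \ coloops M G) ⊆ Q \ coloops M G := fun w hw => (mem_coloops.1 hw).1
    have := Finset.card_sdiff_add_card_eq_card hCsub
    omega

open scoped Classical in
/-- Two distinct thin faces of a covering set `Q` of rank `6` have distinct closures (a common closure of rank `5`
would contain `Q`). -/
theorem clF_ne_of_faces (hG : G ∈ flatsQ M (5 + 1)) {B : Finset α} (hB : B ∈ thinMembers M 5 G)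
    {z : α} (hz : z ∈ G \ clF M B) {w₁ w₂ : α} (hne : w₁ ≠ w₂)
    (hF₁ : (insert z B).erase w₁ ∈ Uq M (5 + 2) 5) (hF₂ : (insert z B).erase w₂ ∈ Uq M (5 + 2) 5) :
    clF M ((insert z B).erase w₁) ≠ clF M ((insert z B).erase w₂) := by
  intro hcl
  have hQ6 : rkN M (insert z B) = 6 := rkN_insert_eq_six_of_thin hG hB hz
  have hQsub : insert z B ⊆ clF M ((insert z B).erase w₁) := by
    intro x hx
    by_cases hxw : x = w₁
    · rw [hcl]
      apply subset_clF hF₂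
      exact Finset.mem_erase.2 ⟨hxw ▸ hne, hx⟩
    · exact subset_clF hF₁ (Finset.mem_erase.2 ⟨hxw, hx⟩)
  have h1 := rkN_mono (M := M) hQsub
  rw [hQ6, rkN_clF_eq_five_of_mem_Uq hF₁] at h1
  omega

/-- `w ↦ Q ∖ w` is injective on `Q`. -/
theorem erase_injOn (Q : Finset α) : Set.InjOn (fun w => Q.erase w) (Q : Set α) := by
  intro w₁ hw₁ w₂ hw₂ h
  dsimp only at h
  by_contra hne
  have : w₂ ∈ Q.erase w₁ := Finset.mem_erase.2 ⟨fun h' => hne h'.symm, hw₂⟩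
  rw [h] at this
  exact (Finset.notMem_erase w₂ Q) this

open scoped Classical in
/-- **`L1 Q ≤ 91/120` AT A LOSSY BIG COVERING SET WITH AT MOST ONE FAT CLOSURE**: at most one of the three thin faces
is fat (`7/24`), the others request at most `7/30`. -/
theorem L1_le_of_loss_ne_zero_one_fat (hG : G ∈ flatsQ M (5 + 1)) (hd : (gr M \ G).card = 2)
    (hk : kColoops M G = 1) (hs : ∀ e ∈ gr M, ∀ f ∈ gr M, e ≠ f → rkN M {e, f} = 2)
    (hl : ∀ e ∈ gr M, M.Indep {e}) (hfat : (fatClosures M 5 G 2).card ≤ 1) {B : Finset α}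
    (hB : B ∈ thinMembers M 5 G) (hbig : 5 ≤ (B \ coloops M G).card) {z : α} (hz : z ∈ G \ clF M B)
    (hl0 : loss M 5 G B z ≠ 0) : L1 M 5 G (insert z B) ≤ 91 / 120 := by
  obtain ⟨hC3, hImg, -, -⟩ := three_thin_faces_of_loss_ne_zero hG hd hk hs hl hB hbig hz hl0
  set Q := insert z B with hQ
  set C := coloops M (Q \ coloops M G) with hC
  have hCQ : ∀ w ∈ C, w ∈ Q := fun w hw => (Finset.mem_sdiff.1 (mem_coloops.1 hw).1).1
  have hthin : ∀ w ∈ C, Q.erase w ∈ thinMembers M 5 G := by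
    intro w hw
    have hmem : Q.erase w ∈ (coverPreimages M (Uq M (5 + 2) 5) G Q).filter (fun F => F ∉ lay0 M 5 G) := by
      rw [hImg, Finset.mem_image]
      exact ⟨w, hw, rfl⟩
    rw [Finset.mem_filter, mem_coverPreimages] at hmem
    exact mem_thinMembers.2 ⟨hmem.1.1, hmem.2⟩
  -- `L1` is the sum of the requests of the three faces
  have hL1eq : L1 M 5 G Q = ∑ w ∈ C, req M 5 (Q.erase w) := by
    unfold L1
    rw [hImg, Finset.sum_image]
    intro w₁ hw₁ w₂ hw₂ h
    exact erase_injOn Q (hCQ w₁ hw₁) (hCQ w₂ hw₂) h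
  -- the fat faces
  set Fat := C.filter (fun w => (G \ clF M (Q.erase w)).card ≤ 2) with hFat
  have hFatsub : Fat ⊆ C := Finset.filter_subset _ _
  have hinj : ∀ w₁ ∈ Fat, ∀ w₂ ∈ Fat, clF M (Q.erase w₁) = clF M (Q.erase w₂) → w₁ = w₂ := by
    intro w₁ hw₁ w₂ hw₂ hcl
    by_contra hne
    exact clF_ne_of_faces hG hB hz hne
      (mem_membersIn.1 (mem_thinMembers.1 (hthin _ (hFatsub hw₁))).1).1
      (mem_membersIn.1 (mem_thinMembers.1 (hthin _ (hFatsub hw₂))).1).1 hcl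
  have hFat1 : Fat.card ≤ 1 := by
    have hmap : ∀ w ∈ Fat, clF M (Q.erase w) ∈ fatClosures M 5 G 2 := by
      intro w hw
      unfold fatClosures
      rw [Finset.mem_image]
      exact ⟨Q.erase w, Finset.mem_filter.2 ⟨hthin w (hFatsub hw), (Finset.mem_filter.1 hw).2⟩, rfl⟩
    exact (Finset.card_le_card_of_injOn (fun w => clF M (Q.erase w)) (fun w hw => hmap w hw)
      (fun w₁ hw₁ w₂ hw₂ h => hinj w₁ hw₁ w₂ hw₂ h)).trans hfat
  have hreqFat : ∀ w ∈ Fat, req M 5 (Q.erase w) ≤ 7 / 24 := fun w hw =>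
    req_le_of_thin_two_one hG hd (hthin w (hFatsub hw))
  have hreqNF : ∀ w ∈ C.filter (fun w => ¬ (G \ clF M (Q.erase w)).card ≤ 2), req M 5 (Q.erase w) ≤ 7 / 30 := by
    intro w hw
    rw [Finset.mem_filter] at hw
    exact req_le_seven_thirtieths_of_not_fat hG hd (hthin w hw.1) hw.2
  have hsplit : Fat.card + (C.filter (fun w => ¬ (G \ clF M (Q.erase w)).card ≤ 2)).card = C.card := by
    rw [hFat]; exact Finset.card_filter_add_card_filter_not _
  have hL1 : L1 M 5 G Q ≤ (Fat.card : ℚ) * (7 / 24) +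
      ((C.filter (fun w => ¬ (G \ clF M (Q.erase w)).card ≤ 2)).card : ℚ) * (7 / 30) := by
    rw [hL1eq, ← Finset.sum_filter_add_sum_filter_not C (fun w => (G \ clF M (Q.erase w)).card ≤ 2), ← hFat]
    have h1 : ∑ w ∈ Fat, req M 5 (Q.erase w) ≤ (Fat.card : ℚ) * (7 / 24) := by
      calc ∑ w ∈ Fat, req M 5 (Q.erase w) ≤ ∑ _w ∈ Fat, (7 / 24 : ℚ) := Finset.sum_le_sum hreqFat
        _ = (Fat.card : ℚ) * (7 / 24) := by rw [Finset.sum_const, nsmul_eq_mul]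
    have h2 : ∑ w ∈ C.filter (fun w => ¬ (G \ clF M (Q.erase w)).card ≤ 2), req M 5 (Q.erase w) ≤
        ((C.filter (fun w => ¬ (G \ clF M (Q.erase w)).card ≤ 2)).card : ℚ) * (7 / 30) := by
      calc ∑ w ∈ C.filter (fun w => ¬ (G \ clF M (Q.erase w)).card ≤ 2), req M 5 (Q.erase w)
          ≤ ∑ _w ∈ C.filter (fun w => ¬ (G \ clF M (Q.erase w)).card ≤ 2), (7 / 30 : ℚ) :=
            Finset.sum_le_sum hreqNF
        _ = _ := by rw [Finset.sum_const, nsmul_eq_mul]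
    linarith
  have hNF : (C.filter (fun w => ¬ (G \ clF M (Q.erase w)).card ≤ 2)).card = 3 - Fat.card := by omega
  rw [hNF] at hL1
  rcases Nat.le_one_iff_eq_zero_or_eq_one.1 hFat1 with h0 | h1
  · rw [h0] at hL1
    norm_num at hL1
    linarith
  · rw [h1] at hL1
    norm_num at hL1
    linarith

open scoped Classical in
/-- **THE FACE LOSSES OF ANY SET SUM TO AT MOST `53/360`** (cell `(2, 1)`, at most one fat closure, every lossy face
big): a set with a lossy big face is a lossy big covering set, whose excess `L1 − capS` is at most `91/120 − 11/18`. -/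
theorem faceLoss_sum_le_one_fat (hG : G ∈ flatsQ M (5 + 1)) (hd : (gr M \ G).card = 2)
    (hk : kColoops M G = 1) (hs : ∀ e ∈ gr M, ∀ f ∈ gr M, e ≠ f → rkN M {e, f} = 2)
    (hl : ∀ e ∈ gr M, M.Indep {e}) (hfat : (fatClosures M 5 G 2).card ≤ 1) (Q : Finset α)
    (hbig : ∀ w ∈ Q, Q.erase w ∈ thinMembers M 5 G → w ∈ G \ clF M (Q.erase w) →
      loss M 5 G (Q.erase w) w ≠ 0 → 5 ≤ (Q.erase w \ coloops M G).card) :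
    ∑ w ∈ Q \ coloops M G, faceLoss M 5 G Q w ≤ 53 / 360 := by
  have hd' : (gr M \ G).card ≤ 5 := by omega
  by_cases hex : ∃ w ∈ Q \ coloops M G, faceLoss M 5 G Q w ≠ 0
  · obtain ⟨w₀, hw₀, hne0⟩ := hex
    have hcond : Q.erase w₀ ∈ thinMembers M 5 G ∧ w₀ ∈ G \ clF M (Q.erase w₀) := by
      by_contra h
      apply hne0
      unfold faceLoss
      rw [if_neg h]
    have hloss : loss M 5 G (Q.erase w₀) w₀ ≠ 0 := by
      unfold faceLoss at hne0
      rwa [if_pos hcond] at hne0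
    have hw₀Q : w₀ ∈ Q := (Finset.mem_sdiff.1 hw₀).1
    have hQeq : insert w₀ (Q.erase w₀) = Q := Finset.insert_erase hw₀Q
    have hbig' := hbig w₀ hw₀Q hcond.1 hcond.2 hloss
    have hL1 := L1_le_of_loss_ne_zero_one_fat hG hd hk hs hl hfat hcond.1 hbig' hcond.2 hloss
    rw [hQeq] at hL1
    have hQG : Q ⊆ G := by
      rw [← hQeq]
      exact Finset.insert_subset (Finset.mem_sdiff.1 hcond.2).1
        ((subset_clF (mem_membersIn.1 (mem_thinMembers.1 hcond.1).1).1).trans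
          (mem_membersIn.1 (mem_thinMembers.1 hcond.1).1).2)
    have hcap := capS_ge_eleven_eighteenths_two_one hd hk hQG
    have hsat : capS M 5 G Q < L1 M 5 G Q := by
      by_contra h
      push Not at h
      apply hloss
      unfold loss fS
      rw [hQeq, if_pos h]
      ring
    have hL := sum_faceLoss_le_L1_mul hG hd' Q
    have hfS : fS M 5 G Q = capS M 5 G Q / L1 M 5 G Q := by
      unfold fS
      rw [if_neg (not_le.2 hsat)]
    have hL1pos : 0 < L1 M 5 G Q := by linarith
    have hexc : L1 M 5 G Q * (1 - fS M 5 G Q) = L1 M 5 G Q - capS M 5 G Q := by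
      rw [hfS]
      field_simp
    linarith
  · push Not at hex
    rw [Finset.sum_eq_zero hex]
    norm_num

end OneFatFaces

end PercRepro.Shadow
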